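import Summits.ResolutionOfSingularities.ResolutionOfSingularities.Theorems.HilbertSamuelEliminationCampaignW42TertiaryLiveness
import Literature.AlgebraicGeometry.Resolution.Blowups
import Literature.AlgebraicGeometry.Resolution.HilbertSamuelLocal
import HarnessLib

/-!
# [OURS · L1 W4.2] The canonical centres of `S(X, ν)` lie in the `ν`-strata; with regular centres they are permissible —
# hypothesis (H3) of the O2 ⇒ `ν`-modification bridge reduced to `AllRegular`
# (`--supports stmt-ResolutionOfSingularities-17846`)

OURS (slot W4.2 of cell res-hironaka, LADDER-RESOLUTION rung L, D-0089; prover seat res-L1-s42-pv-2, gen 2); NOT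
statements of H. Hironaka's manuscript [Hironaka2017]; nothing of the manuscript is used or asserted. AI review is
weaker than expert review. Pure PROOF file; no new definition.

The Elimination/Liveness files (p481040, p481517, p481807) proved
`TertiaryTermination p ⇒ TameWild.NuMod X N d ν` at isolated maximal strata modulo (H2) «the oracle answers on the
strata» and (H3) «the canonical centres are permissible and lie in the successive `ν`-strata» (CJS p. 92
«Y_{0,i} = Y_i^{(0)}» with Rem. 6.29 (1) «also permissible … by Lemma 5.34 (3)»). This file PROVES THE IN-STRATUM HALF
OF (H3) for every canonical run from an isolated origin, and with it reduces (H3) to REGULARITY of the canonical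
centres (`CentreSeq.AllRegular`, the shape of every Corridor3 stub):

* `hsFun_blowup_eq_of_notMem_support` — off the centre a blow-up preserves `H^N` (iso off the centre, GW 13.91 (3) /
  Stacks 02OS, tree `IsBlowup.isIso_compl`; `H^N` depends only on the local ring, tree `Scheme.hsFun_eq_of_isOpenImmersion`).
* `strictTransformSet_subset_hsStratum` — THE STRICT TRANSFORM OF A SUBSET OF `X_n(ν)` LIES IN `X_{n+1}(ν)` as soon as
  `X_{n+1}(ν)` is closed: `closure π⁻¹(T ∖ V(C)) ⊆ X_{n+1}(ν)` (CJS p. 92: «`Y_{0,i}` is the strict transform of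
  `Y_{0,i-1}`» stays inside the `ν̃`-locus).
* `support_subset_of_isReplayStep` / `range_hom_subset_hsStratum_of_isReplayStep` — along a replay step from a
  replayed subscheme INSIDE the stratum, the centre lies in the stratum and the next replayed subscheme (the strict
  transform, tree `IsReplayStep.range_hom_eq_strictTransformSet`, GW 13.96 (2)) lies in the next stratum.
* `isCanonicalStep_centre_package` — ONE CANONICAL STEP from a state over `k` (finite type, reduced, `dim ≤ N`, `ν` never
  exceeded, replayed subscheme inside the stratum) with a REGULAR centre: the centre lies in `X_n(ν)`, is PERMISSIBLE
  (res-L1-w42-stub-3's `Helpers.isPermissible_of_isRegular_subscheme_of_support_subset_hsStratum_of_isExcellent`,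
  CJS Thm. 3.3, for `ν ≠ Φ^{(N)}`), `H^N` does not increase (Bennett–Hironaka–Singh, CJS Thm. 3.10 (1), PROVED in the
  tree), and the next state is again of the same kind.
* `allPermissible_and_centresInStratum_of_allRegular` — along every canonical run from such a state whose canonical
  centres are regular: all centres permissible and in the strata (induction along the run).
* `canonicalCentres_of_allRegular` — AT AN ISOLATED ORIGIN of characteristic `p` with `ν ≠ Φ^{(N)}`:
  `(∀ t, t.IsCanonicalRun R N ν → t.AllRegular) → ∀ t, t.IsCanonicalRun R N ν → t.AllPermissible ∧ t.CentresInStratum N ν`.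
* `nuMod_of_tertiaryTermination_of_allRegular` — THE HEADLINE WITH (H3) := `AllRegular`: `TertiaryTermination p`, a
  functional admissible oracle answering on the strata whose canonical centres are REGULAR, `ν ≠ Φ^{(N)}` ⇒
  `TameWild.NuMod X N d ν` at every isolated maximal stratum, every dimension; `nuMod_of_noNearChain_of_allRegular` the
  existential-oracle form. What remains of «Y_{0,i} = Y_i^{(0)}» is exactly: THE CYCLE-ENDING CENTRES `Y_n^{(j)}`
  (reduced) ARE REGULAR (for the replayed centres `φ_* D` regularity is that of the oracle's permissible `D`).

## References

* V. Cossart, U. Jannsen, S. Saito, LNM 2270 (2020), Rem. 6.29 (1) pp. 91–92, p. 92, Thm. 3.3, Thm. 3.10 (1),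
  Lemma 5.34 (3), Def. 6.14. [CossartJannsenSaito2020]
* U. Görtz, T. Wedhorn, *Algebraic Geometry I* (2nd ed. 2020), Prop. 13.91 (3), Prop. 13.96 (2). [GortzWedhorn2020]
-/

noncomputable section

set_option linter.dupNamespace false -- mandated namespace of this single-conjunct summit

open CategoryTheory AlgebraicGeometry TopologicalSpace Topology

namespace Summit.ResolutionOfSingularities.ResolutionOfSingularities.Theorems

namespace CampaignW42

open Literature.AlgebraicGeometry.Resolution Literature.RingTheory.HilbertSamuel
open Summit.ResolutionOfSingularities.ResolutionOfSingularities.Theorems.SigmaMaxModificationsCorridor3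

universe u

variable {p : ℕ} {R : ∀ S : Scheme.{u}, CentreSeq S → Prop} {N : ℕ} {ν : ℕ → ℕ}
variable {k : Type u} [Field k]

/-! ## Off the centre a blow-up preserves `H^N`; strict transforms of subsets of the stratum -/

/-- **Off its centre a blow-up preserves the Hilbert–Samuel function**: for `y ∈ Bl_C(W)` with `π(y) ∉ V(C)`,
`H^N_{Bl_C W}(y) = H^N_W(π y)` (`π` is an isomorphism over `W ∖ V(C)`, GW Prop. 13.91 (3); `H^N` depends only on the
local ring). [cite: GortzWedhorn2020, Prop. 13.91 (3)] [cite: CossartJannsenSaito2020, Def. 2.28] -/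
theorem hsFun_blowup_eq_of_notMem_support {W : Scheme.{u}} [IsLocallyNoetherian W] (C : W.IdealSheafData)
    [IsLocallyNoetherian (blowup C)] (N : ℕ) (y : ↥(blowup C)) (hy : (blowup.π C).base y ∉ (C.support : Set W)) :
    Scheme.hsFun (blowup C) N y = Scheme.hsFun W N ((blowup.π C).base y) := by
  let U : W.Opens := ⟨(C.support : Set W)ᶜ, C.support.isClosed.isOpen_compl⟩
  haveI : IsIso (blowup.π C ∣_ U) := (blowup.isBlowup C).isIso_compl
  have hfac : (blowup.π C ⁻¹ᵁ U).ι ≫ blowup.π C = (blowup.π C ∣_ U) ≫ U.ι := (morphismRestrict_ι _ U).symm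
  let y' : ↥(blowup.π C ⁻¹ᵁ U) := ⟨y, hy⟩
  have h1 : Scheme.hsFun (↑(blowup.π C ⁻¹ᵁ U)) N y' = Scheme.hsFun W N (((blowup.π C ∣_ U) ≫ U.ι).base y') :=
    Scheme.hsFun_eq_of_isOpenImmersion ((blowup.π C ∣_ U) ≫ U.ι) N y'
  have h2 : Scheme.hsFun (↑(blowup.π C ⁻¹ᵁ U)) N y' = Scheme.hsFun (blowup C) N ((blowup.π C ⁻¹ᵁ U).ι.base y') :=
    Scheme.hsFun_eq_of_isOpenImmersion (blowup.π C ⁻¹ᵁ U).ι N y'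
  have hy' : (blowup.π C ⁻¹ᵁ U).ι.base y' = y := rfl
  rw [← hy', ← h2, h1, ← Scheme.Hom.comp_apply, ← hfac, Scheme.Hom.comp_apply]

/-- **THE STRICT TRANSFORM OF A SUBSET OF THE STRATUM LIES IN THE NEXT STRATUM** once the latter is closed: for
`T ⊆ W(ν)`, `closure π⁻¹(T ∖ V(C)) ⊆ Bl_C(W)(ν)` — off the centre `H^N` is unchanged, and the closure stays in the
closed `ν`-stratum upstairs (CJS p. 92: the replayed strict transforms stay in the `ν̃`-locus).
[cite: CossartJannsenSaito2020, Rem. 6.29 (1), p. 92] -/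
theorem strictTransformSet_subset_hsStratum {W : Scheme.{u}} [IsLocallyNoetherian W] (C : W.IdealSheafData)
    [IsLocallyNoetherian (blowup C)] {T : Set W} (hT : T ⊆ Scheme.hsStratum W N ν)
    (hcl : IsClosed (Scheme.hsStratum (blowup C) N ν)) :
    strictTransformSet (blowup.π C) (C.support : Set W) T ⊆ Scheme.hsStratum (blowup C) N ν := by
  refine closure_minimal (fun y hy => ?_) hcl
  obtain ⟨hyT, hyC⟩ := hy
  rw [Scheme.mem_hsStratum_iff, hsFun_blowup_eq_of_notMem_support C N y hyC]
  exact Scheme.mem_hsStratum_iff.mp (hT hyT)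

/-! ## Replay steps from a replayed subscheme inside the stratum -/

/-- **The centre of a replay step lies in the stratum** when the replayed subscheme does (and the parts are taken in a
closed `Y`): the cycle-ending centre is `Y^{(j)} ⊆ Y`, a replayed centre `φ_* D` has support
`closure φ(V(D)) ⊆ closure φ(S) ⊆ Y`. [cite: CossartJannsenSaito2020, Rem. 6.29 (1)] -/
theorem support_subset_of_isReplayStep {W : Scheme.{u}} {L : Labelling W} {Y : Set W} (hY : IsClosed Y) {j : ℕ}
    {S : Scheme.{u}} {φ : S ⟶ W} [QuasiCompact φ] (hφ : Set.range φ.base ⊆ Y) {t : CentreSeq S}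
    {C : W.IdealSheafData} {P' : Option (Pending (blowup C))} (h : IsReplayStep L Y j φ t C P') :
    (C.support : Set W) ⊆ Y := by
  cases t with
  | nil _ => exact h.support_subset
  | cons D t' =>
    rw [h.support_eq_closure]
    refine closure_minimal ?_ hY
    rintro _ ⟨z, -, rfl⟩
    exact hφ ⟨z, rfl⟩

/-- **The next replayed subscheme lies in the next stratum**: along a replay step from a replayed subscheme inside
`W(ν)` (closed immersion `φ`), the identification carried on is onto the strict transform
(`IsReplayStep.range_hom_eq_strictTransformSet`, GW 13.96 (2)), which lies in `Bl_C(W)(ν)` when that stratum is closed.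
[cite: CossartJannsenSaito2020, Rem. 6.29 (1), p. 92] [cite: GortzWedhorn2020, Prop. 13.96 (2)] -/
theorem range_hom_subset_hsStratum_of_isReplayStep {W : Scheme.{u}} [IsLocallyNoetherian W] {L : Labelling W}
    {j : ℕ} {S : Scheme.{u}} {φ : S ⟶ W} [IsClosedImmersion φ]
    (hφ : Set.range φ.base ⊆ Scheme.hsStratum W N ν) {t : CentreSeq S} {C : W.IdealSheafData}
    [IsLocallyNoetherian (blowup C)] {P' : Option (Pending (blowup C))}
    (h : IsReplayStep L (Scheme.hsStratum W N ν) j φ t C P') (hcl : IsClosed (Scheme.hsStratum (blowup C) N ν)) :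
    ∀ Q', P' = some Q' → Set.range Q'.hom.base ⊆ Scheme.hsStratum (blowup C) N ν := by
  cases t with
  | nil _ =>
    obtain ⟨-, rfl⟩ := h
    intro Q' hQ'
    exact absurd hQ' (by simp)
  | cons D t' =>
    obtain ⟨P'', hP'', hrange⟩ := h.range_hom_eq_strictTransformSet
    intro Q' hQ'
    obtain rfl : Q' = P'' := by rw [hP''] at hQ'; exact (Option.some_injective _ hQ').symm
    rw [hrange]
    exact strictTransformSet_subset_hsStratum C hφ hcl

/-! ## One canonical step with a regular centre -/

/-- **ONE CANONICAL STEP, CENTRE PACKAGE.** From a state over the field `k` — the stage of finite type over `k`,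
reduced, `dim ≤ N`, `ν ≠ Φ^{(N)}` never exceeded by `H^N`, and the replayed subscheme (if a cycle is in progress) inside
the `ν`-stratum — a canonical step WITH REGULAR CENTRE has: its centre inside `X_n(ν)`; its centre PERMISSIBLE (CJS
Thm. 3.3 via `Helpers.isPermissible_of_isRegular_subscheme_of_support_subset_hsStratum_of_isExcellent`); `H^N`
non-increasing along the blow-up (CJS Thm. 3.10 (1), proved in the tree); and the next state of the same kind (blow-up of
finite type over `k`, reduced by CJS Thm. 6.6 / tree `IsBlowup.isReduced_of_isReduced`, `dim ≤ N`, `ν` never exceeded,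
the new replayed subscheme inside `X_{n+1}(ν)`). [cite: CossartJannsenSaito2020, Thm. 3.3, Thm. 3.10 (1), Rem. 6.29 (1), p. 92] -/
theorem isCanonicalStep_centre_package (hν : ν ≠ iterPSum N Phi) {W : Scheme.{u}} {L : Labelling W}
    {P : Option (Pending W)} (hk : ∃ f : W ⟶ Spec (.of k), LocallyOfFiniteType f ∧ QuasiCompact f)
    (hred : IsReduced W) (hdim : topologicalKrullDim W ≤ (N : WithBot ℕ∞))
    (hsup : ∀ w : W, ν ≤ Scheme.hsFun W N w → Scheme.hsFun W N w = ν)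
    (hinv : ∀ Q, P = some Q → Set.range Q.hom.base ⊆ Scheme.hsStratum W N ν)
    {C : W.IdealSheafData} {P' : Option (Pending (blowup C))} (hst : IsCanonicalStep R N ν L P C P')
    (hCreg : Scheme.IsRegular C.subscheme) :
    (C.support : Set W) ⊆ Scheme.hsStratum W N ν ∧ IdealSheafData.IsPermissible C ∧
      (∀ z : ↥(blowup C), Scheme.hsFun (blowup C) N z ≤ Scheme.hsFun W N ((blowup.π C).base z)) ∧
      (∃ f' : blowup C ⟶ Spec (.of k), LocallyOfFiniteType f' ∧ QuasiCompact f') ∧ IsReduced (blowup C) ∧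
      topologicalKrullDim (blowup C) ≤ (N : WithBot ℕ∞) ∧
      (∀ z : ↥(blowup C), ν ≤ Scheme.hsFun (blowup C) N z → Scheme.hsFun (blowup C) N z = ν) ∧
      ∀ Q', P' = some Q' → Set.range Q'.hom.base ⊆ Scheme.hsStratum (blowup C) N ν := by
  obtain ⟨f, hft, hqc⟩ := hk
  haveI := hft
  haveI := hqc
  haveI := hred
  haveI : IsLocallyNoetherian W := LocallyOfFiniteType.isLocallyNoetherian f
  haveI : IsNoetherian W := Scheme.isNoetherian_of_finiteType_over_field f
  have hexc : Scheme.IsExcellent W := Scheme.isExcellent_of_locallyOfFiniteType Stacks07QW_field_holds f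
  have hYcl : IsClosed (Scheme.hsStratum W N ν) := by
    rw [hsStratum_eq_hsStratumGE_of_supMax hsup]
    exact isClosed_hsStratumGE_over_field f hdim ν
  -- (i) the centre lies in the stratum
  have hCsub : (C.support : Set W) ⊆ Scheme.hsStratum W N ν := by
    cases P with
    | none =>
      obtain ⟨j, -, hpart, t, -, hs⟩ := hst
      refine support_subset_of_isReplayStep hYcl ?_ hs
      rw [Scheme.IdealSheafData.range_subschemeι, Scheme.IdealSheafData.coe_support_vanishingIdeal]
      exact L.part_subset _ j
    | some Q =>
      haveI := Q.isClosedImmersion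
      exact support_subset_of_isReplayStep hYcl (hinv Q rfl) hst.2
  -- (ii) permissible
  have hperm : IdealSheafData.IsPermissible C :=
    Helpers.isPermissible_of_isRegular_subscheme_of_support_subset_hsStratum_of_isExcellent hexc hdim hν C hCreg hCsub
  -- (iii) `H^N` monotone, next state
  haveI : IsProper (blowup.π C) := (blowup.isBlowup C).isProper
  haveI : IsLocallyNoetherian (blowup C) := LocallyOfFiniteType.isLocallyNoetherian (blowup.π C ≫ f)
  have hmono : ∀ z : ↥(blowup C), Scheme.hsFun (blowup C) N z ≤ Scheme.hsFun W N ((blowup.π C).base z) :=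
    fun z => (blowup.isBlowup C).hsFun_le_of_isPermissible hexc hperm N z
  have hsup' : ∀ z : ↥(blowup C), ν ≤ Scheme.hsFun (blowup C) N z → Scheme.hsFun (blowup C) N z = ν := by
    intro z hz
    have hle := hmono z
    have heq := hsup _ (hz.trans hle)
    exact le_antisymm (heq ▸ hle) hz
  have hdim' : topologicalKrullDim (blowup C) ≤ (N : WithBot ℕ∞) :=
    (blowup.isBlowup C).topologicalKrullDim_le_of_isLocallyNoetherian hdim
  have hYcl' : IsClosed (Scheme.hsStratum (blowup C) N ν) := by
    rw [hsStratum_eq_hsStratumGE_of_supMax hsup']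
    exact isClosed_hsStratumGE_over_field (blowup.π C ≫ f) hdim' ν
  refine ⟨hCsub, hperm, hmono, ⟨blowup.π C ≫ f, inferInstance, inferInstance⟩,
    (blowup.isBlowup C).isReduced_of_isReduced, hdim', hsup', ?_⟩
  -- (iv) the new replayed subscheme lies in the new stratum
  cases P with
  | none =>
    obtain ⟨j, -, hpart, t, -, hs⟩ := hst
    refine range_hom_subset_hsStratum_of_isReplayStep ?_ hs hYcl'
    rw [Scheme.IdealSheafData.range_subschemeι, Scheme.IdealSheafData.coe_support_vanishingIdeal]
    exact L.part_subset _ j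
  | some Q =>
    haveI := Q.isClosedImmersion
    exact range_hom_subset_hsStratum_of_isReplayStep (hinv Q rfl) hst.2 hYcl'

/-! ## Along canonical runs with regular centres -/

/-- **ALONG A CANONICAL RUN WITH REGULAR CENTRES, from a state over `k` as in `isCanonicalStep_centre_package`, ALL
CENTRES ARE PERMISSIBLE AND LIE IN THE SUCCESSIVE `ν`-STRATA** (induction along the run: the state propagates).
[cite: CossartJannsenSaito2020, Rem. 6.29 (1), p. 92, Lemma 5.34 (3), Thm. 3.3] -/
theorem allPermissible_and_centresInStratum_of_allRegular (hν : ν ≠ iterPSum N Phi) :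
    ∀ {W : Scheme.{u}} {L : Labelling W} {P : Option (Pending W)},
      (∃ f : W ⟶ Spec (.of k), LocallyOfFiniteType f ∧ QuasiCompact f) → IsReduced W →
      topologicalKrullDim W ≤ (N : WithBot ℕ∞) →
      (∀ w : W, ν ≤ Scheme.hsFun W N w → Scheme.hsFun W N w = ν) →
      (∀ Q, P = some Q → Set.range Q.hom.base ⊆ Scheme.hsStratum W N ν) →
      ∀ (t : CentreSeq W), IsCanonicalRunFrom R N ν L P t → t.AllRegular →
        t.AllPermissible ∧ t.CentresInStratum N ν
  | W, L, P, _, _, _, _, _, CentreSeq.nil _, _, _ => ⟨trivial, trivial⟩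
  | W, L, P, hk, hred, hdim, hsup, hinv, CentreSeq.cons C rest, ht, hreg => by
    obtain ⟨P', hst, hrest⟩ := ht
    obtain ⟨hCreg, hrestreg⟩ := (CentreSeq.allRegular_cons C rest).mp hreg
    obtain ⟨hCsub, hperm, -, hk', hred', hdim', hsup', hinv'⟩ :=
      isCanonicalStep_centre_package (k := k) hν hk hred hdim hsup hinv hst hCreg
    obtain ⟨hrestperm, hreststr⟩ :=
      allPermissible_and_centresInStratum_of_allRegular hν hk' hred' hdim' hsup' hinv' rest hrest hrestreg
    exact ⟨(CentreSeq.allPermissible_cons C rest).mpr ⟨hperm, hrestperm⟩,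
      (CentreSeq.centresInStratum_cons C rest).mpr ⟨hCsub, hreststr⟩⟩

/-- **AT AN ISOLATED ORIGIN: canonical runs with regular centres have permissible centres in the strata** (`ν ≠ Φ^{(N)}`):
hypothesis (H3) of the O2 ⇒ `ν`-modification bridge follows from `AllRegular`. What is NOT proved is the regularity
itself of the cycle-ending centres `Y_n^{(j)}` — CJS p. 92 «Y_{j,m} = Y_m^{(j)}» proper.
[cite: CossartJannsenSaito2020, Rem. 6.29 (1), p. 92, Lemma 5.34 (3)] -/
theorem canonicalCentres_of_allRegular {X : Scheme.{u}} [IsLocallyNoetherian X] {x : X}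
    (hX : IsIsolatedOrigin p N ν X x) (hν : ν ≠ iterPSum N Phi)
    (hreg : ∀ t : CentreSeq X, t.IsCanonicalRun R N ν → t.AllRegular) (t : CentreSeq X)
    (ht : t.IsCanonicalRun R N ν) : t.AllPermissible ∧ t.CentresInStratum N ν := by
  obtain ⟨k, _, _, f, -, hft, hqc⟩ := hX.exists_structure
  have hsup : ∀ w : X, ν ≤ Scheme.hsFun X N w → Scheme.hsFun X N w = ν :=
    fun w hw => le_antisymm (hX.maximal.2 ⟨w, rfl⟩ hw) hw
  exact allPermissible_and_centresInStratum_of_allRegular (k := k) hν ⟨f, hft, hqc⟩ hX.isReduced hX.dim_le hsup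
    (fun Q hQ => absurd hQ (by simp)) t ht (hreg t ht)

/-- In particular the initial state of an isolated origin whose canonical centres are regular is GOOD in the sense of the
States file (`StateGood`, p477843): every canonical run has permissible centres. [folklore] -/
theorem stateGood_init_of_allRegular {X : Scheme.{u}} [IsLocallyNoetherian X] {x : X}
    (hX : IsIsolatedOrigin p N ν X x) (hν : ν ≠ iterPSum N Phi)
    (hreg : ∀ t : CentreSeq X, t.IsCanonicalRun R N ν → t.AllRegular) (f : X ⟶ Spec (.of k))
    [LocallyOfFiniteType f] [QuasiCompact f] : StateGood k R N ν X (Labelling.init X) none :=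
  ⟨⟨f, ‹_›, ‹_›⟩, hX.dim_le, fun w hw => le_antisymm (hX.maximal.2 ⟨w, rfl⟩ hw) hw,
    fun t ht => (canonicalCentres_of_allRegular hX hν hreg t ht).1⟩

/-! ## The headline with (H3) := `AllRegular` -/

/-- **WHAT O2 BUYS, (H3) REDUCED TO REGULAR CENTRES — `TertiaryTermination p ⇒ ν-MODIFICATION OF EVERY ISOLATED
MAXIMAL STRATUM`, every dimension:** `X` reduced of finite type over a field of characteristic `p`, `dim X ≤ d`,
`dim X ≤ N`, `ν ≠ Φ^{(N)}` maximal in `Σ_X(N)`, `X(ν) = {x}` with `x` closed; `R` a functional admissible oracle which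
answers on the reduced closed non-empty subsets of the `ν`-strata met along `S(X, ν)` (induction on dimension) and
whose canonical centres are REGULAR (for the replayed centres: the oracle's permissible centres; for the cycle-ending
centres `Y_n^{(j)}`: CJS p. 92). Then `TameWild.NuMod X N d ν`. No undischarged named fact; O2 is the hypothesis
`TertiaryTermination p`. [cite: CossartJannsenSaito2020, Def. 6.14, Rem. 6.29 (1), p. 92, p. 107, Thm. 3.3] -/
theorem nuMod_of_tertiaryTermination_of_allRegular {p : ℕ} (h : TertiaryTermination.{0} p)
    {R : ∀ S : Scheme.{0}, CentreSeq S → Prop} {N : ℕ} {ν : ℕ → ℕ} (hRf : OracleFunctional R)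
    (hRa : OracleAdmissible R) {X : Scheme.{0}} [IsLocallyNoetherian X] {x : X} (hX : IsIsolatedOrigin p N ν X x)
    {d : ℕ} (hdimd : topologicalKrullDim X ≤ (d : WithBot ℕ∞)) (hν : ν ≠ iterPSum N Phi)
    (hreg : ∀ t : CentreSeq X, t.IsCanonicalRun R N ν → t.AllRegular)
    (htotal : ∀ s : CentreSeq X, s.IsCanonicalRun R N ν → ∀ (Z : Set s.top) (hZ : IsClosed Z),
      Z ⊆ Scheme.hsStratum s.top N ν → Z.Nonempty →
        ∃ t, R (Scheme.IdealSheafData.vanishingIdeal ⟨Z, hZ⟩).subscheme t) :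
    TameWild.NuMod X N d ν :=
  nuMod_of_tertiaryTermination_of_answers h hRf hRa hX hdimd (canonicalCentres_of_allRegular hX hν hreg) htotal

/-- **The existential-oracle form with (H3) := `AllRegular`:** one functional admissible oracle answering on the strata,
with regular canonical centres and no infinite near chain from `(X, x)`, gives `TameWild.NuMod X N d ν` (`ν ≠ Φ^{(N)}`).
[cite: CossartJannsenSaito2020, Def. 6.14, Rem. 6.29 (1)] -/
theorem nuMod_of_noNearChain_of_allRegular {p : ℕ} {R : ∀ S : Scheme.{0}, CentreSeq S → Prop} {N : ℕ} {ν : ℕ → ℕ}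
    (hRf : OracleFunctional R) {X : Scheme.{0}} [IsLocallyNoetherian X] {x : X} (hX : IsIsolatedOrigin p N ν X x)
    {d : ℕ} (hdimd : topologicalKrullDim X ≤ (d : WithBot ℕ∞)) (hν : ν ≠ iterPSum N Phi)
    (hreg : ∀ t : CentreSeq X, t.IsCanonicalRun R N ν → t.AllRegular)
    (htotal : ∀ s : CentreSeq X, s.IsCanonicalRun R N ν → ∀ (Z : Set s.top) (hZ : IsClosed Z),
      Z ⊆ Scheme.hsStratum s.top N ν → Z.Nonempty →
        ∃ t, R (Scheme.IdealSheafData.vanishingIdeal ⟨Z, hZ⟩).subscheme t)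
    (hno : NoNearChainFrom R N ν (MarkedStage.init X x) fun _ => True) : TameWild.NuMod X N d ν :=
  nuMod_of_noNearChain_of_answers hRf hX hdimd (canonicalCentres_of_allRegular hX hν hreg) htotal hno

/-- **The equivalences at an isolated origin with regular canonical centres and an oracle answering on the strata**
(functional oracle, `ν ≠ Φ^{(N)}`): no infinite near chain ⟺ `S(X, ν)` terminates ⟺ `S(X, ν)` is not infinite.
[cite: CossartJannsenSaito2020, Rem. 6.29 (1), p. 107] -/
theorem noNearChain_iff_terminates_iff_not_infinite_of_allRegular (hRf : OracleFunctional R) {X : Scheme.{u}}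
    [IsLocallyNoetherian X] {x : X} (hX : IsIsolatedOrigin p N ν X x) (hν : ν ≠ iterPSum N Phi)
    (hreg : ∀ t : CentreSeq X, t.IsCanonicalRun R N ν → t.AllRegular)
    (htotal : ∀ s : CentreSeq X, s.IsCanonicalRun R N ν → ∀ (Z : Set s.top) (hZ : IsClosed Z),
      Z ⊆ Scheme.hsStratum s.top N ν → Z.Nonempty →
        ∃ t, R (Scheme.IdealSheafData.vanishingIdeal ⟨Z, hZ⟩).subscheme t) :
    ((NoNearChainFrom R N ν (MarkedStage.init X x) fun _ => True) ↔ CanonicalSequenceTerminates R N ν X) ∧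
      (CanonicalSequenceTerminates R N ν X ↔ ¬ CanonicalSequenceInfinite R N ν X) :=
  noNearChain_iff_terminates_iff_not_infinite_of_answers hRf hX
    (fun t ht => (canonicalCentres_of_allRegular hX hν hreg t ht).1) htotal

end CampaignW42

end Summit.ResolutionOfSingularities.ResolutionOfSingularities.Theorems

end
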